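import Summits.BirchSwinnertonDyer.Rank2.LevelFifteenRedPfree
import Summits.BirchSwinnertonDyer.Rank2.FrobeniusExponentsAtTwoSmall
import HarnessLib

/-!
# The BC5 rung: (★-core) for `15A8` modulo `T⁸`, kernel-checked

Cell `bsd-rank2` (D-0036), seat `bsd-rank2-eng` GEN 9 (director-bsd g9 ruling (R3): «BC5 rung — (★_S) mod T⁸ on 15A8 via the
level-15 presentation»; line `star`, crux E1M stmt-BirchSwinnertonDyer-20341). In the currency of the line's `StarCoreAtTwo`
(`MuLambda.red ∘ MuLambda.pfree`, `frobeniusSeries`, `PowerSeries.binomialSeries`), for `W = [1,1,1,0,0]` (`N = 15 = 3·5`, both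
primes of multiplicative reduction, exponents `1`), with the binomial exponent `e = 5` (`= 1 − f₁₅ (mod 8)`, the EXACT translation):

**`starCore_refFifteen_mod_T8`**: for every newform `f` of `W`, every nonzero `L₀, G₀, G₀^ι ∈ Λ` with `ι L₀ = c·L₂(f,α)`,
`ι G₀ = c_g·G`, `ι G₀^ι = c_i·G^ι`:
`T⁸ ∣ T²·red(pfree L₀) − red((1+T)⁵)·red(pfree G₀)·red(pfree G₀^ι)·(red(γ₃ − 1)·red(γ₅ − 1))` in `𝔽₂⟦T⟧`.

All inputs are tree theorems of this seat's chain (parts III–VIII, the Kubota–Leopoldt companions, `LevelFifteenRedPfree`,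
`BinomialSeriesRedModTwoPow`, `FrobeniusExponentsAtTwoSmall`); the last step is the integer certificate
`RHS − LHS = 2·Q + T⁸·R` in `ℤ[T]` (explicit `Q, R` below) read in characteristic `2`.

THEOREMS ONLY (no definition, no named fact, no `sorry`). PARTITION: none — r_an ≥ 2, summit axis S0; TWIN (D-0056): n/a.
B1 honesty: finite arithmetic; nothing reads an analytic rank; no S0 motion.

References: B. Mazur, J. Tate, J. Teitelbaum, *Invent. Math.* 84 (1986) §I.10–§I.13 [MazurTateTeitelbaum1986Invent];
R. Greenberg, V. Vatsal, *Invent. Math.* 142 (2000) §1 [GreenbergVatsal2000].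
-/

noncomputable section

open scoped MatrixGroups ModularForm

open CongruenceSubgroup Literature.NumberTheory.EllipticCurves Literature.NumberTheory.EllipticCurves.ModularForms
open Literature.NumberTheory.EllipticCurves.GreenbergVatsal2000
open Summit.BirchSwinnertonDyer.Rank1Residual.X1

namespace Summit.BirchSwinnertonDyer.Rank2.LevelFifteen

/-- From eight coefficient values to a congruence modulo `T⁸`. [folklore] -/
theorem X_pow_eight_dvd_sub_of_coeff {F P : PowerSeries (IsLocalRing.ResidueField ℤ_[2])}
    (h : ∀ k < 8, PowerSeries.coeff k F = PowerSeries.coeff k P) :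
    (PowerSeries.X : PowerSeries (IsLocalRing.ResidueField ℤ_[2])) ^ 8 ∣ F - P := by
  refine PowerSeries.X_pow_dvd_iff.mpr fun m hm ↦ ?_
  rw [map_sub, h m hm, sub_self]

/-- **The BC5 rung: (★-core) for `15A8` modulo `T⁸`.** [cite: MazurTateTeitelbaum1986Invent, §I.10–§I.13]
[cite: GreenbergVatsal2000, §1] -/
theorem starCore_refFifteen_mod_T8 (hmin : (⟨1, 1, 1, 0, 0⟩ : WeierstrassCurve ℚ).IsGloballyMinimal)
    ⦃N : ℕ⦄ [NeZero N] (f : CuspForm (Gamma0 N) 2) (hW : IsNewformOf (⟨1, 1, 1, 0, 0⟩ : WeierstrassCurve ℚ) f)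
    (c : ℚ) (L₀ : IwasawaAlgebra 2) (hL₀ : L₀ ≠ 0)
    (hιL : iwasawaToPowerSeries 2 L₀ = PowerSeries.C (c : ℚ_[2]) *
      padicLFunction f (@unitRoot (⟨1, 1, 1, 0, 0⟩ : WeierstrassCurve ℚ) hmin 2 _ : ℚ_[2]))
    (cg : ℚ_[2]) (G₀ : IwasawaAlgebra 2) (hG₀ : G₀ ≠ 0)
    (hιG : iwasawaToPowerSeries 2 G₀ = PowerSeries.C cg * klTwoNumerator)
    (ci : ℚ_[2]) (GI₀ : IwasawaAlgebra 2) (hGI₀ : GI₀ ≠ 0)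
    (hιGI : iwasawaToPowerSeries 2 GI₀ = PowerSeries.C ci * klTwoNumeratorInv) :
    (PowerSeries.X : PowerSeries (IsLocalRing.ResidueField ℤ_[2])) ^ 8 ∣
      PowerSeries.X ^ 2 * MuLambda.red (MuLambda.pfree L₀) -
        MuLambda.red (PowerSeries.binomialSeries ℤ_[2] ((5 : ℕ) : ℤ_[2])) * MuLambda.red (MuLambda.pfree G₀) *
          MuLambda.red (MuLambda.pfree GI₀) *
          (MuLambda.red (frobeniusSeries 2 3 - 1) * MuLambda.red (frobeniusSeries 2 5 - 1)) := by
  haveI : CharP (IsLocalRing.ResidueField ℤ_[2]) 2 := Rank1Residual.Supersingular.charP_residueField_two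
  haveI : Fact (Nat.Prime 2) := ⟨Nat.prime_two⟩
  haveI : CharP (PowerSeries (IsLocalRing.ResidueField ℤ_[2])) 2 :=
    charP_of_injective_ringHom (f := PowerSeries.C) (PowerSeries.C_injective) 2
  -- abbreviations
  set 𝕏 : PowerSeries (IsLocalRing.ResidueField ℤ_[2]) := PowerSeries.X with h𝕏
  set PL : PowerSeries (IsLocalRing.ResidueField ℤ_[2]) := 1 + 𝕏 ^ 3 + 𝕏 ^ 4 + 𝕏 ^ 6 with hPL
  set PG : PowerSeries (IsLocalRing.ResidueField ℤ_[2]) := 1 + 𝕏 ^ 2 + 𝕏 ^ 5 + 𝕏 ^ 7 with hPG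
  set PI : PowerSeries (IsLocalRing.ResidueField ℤ_[2]) := 1 + 𝕏 ^ 2 + 𝕏 ^ 4 + 𝕏 ^ 5 with hPI
  set P3 : PowerSeries (IsLocalRing.ResidueField ℤ_[2]) := (1 + 𝕏) ^ 3 - 1 with hP3
  -- residues of the bit values
  have r1 : IsLocalRing.residue ℤ_[2] (((1 : ℤ)) : ℤ_[2]) = 1 := by push_cast; exact map_one _
  have r0 : IsLocalRing.residue ℤ_[2] (((0 : ℤ)) : ℤ_[2]) = 0 := by push_cast; exact map_zero _
  -- (1) the curve side
  have hL := red_pfree_refFifteen hmin f hW c L₀ hL₀ hιL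
  have hL8 : 𝕏 ^ 8 ∣ MuLambda.red (MuLambda.pfree L₀) - PL := by
    refine X_pow_eight_dvd_sub_of_coeff fun k hk ↦ ?_
    interval_cases k
    · rw [hL (0, 1) (by simp), r1]; simp [hPL, h𝕏]
    · rw [hL (1, 0) (by simp), r0]; simp [hPL, h𝕏, PowerSeries.coeff_X_pow]
    · rw [hL (2, 0) (by simp), r0]; simp [hPL, h𝕏, PowerSeries.coeff_X_pow]
    · rw [hL (3, 1) (by simp), r1]; simp [hPL, h𝕏, PowerSeries.coeff_X_pow]
    · rw [hL (4, 1) (by simp), r1]; simp [hPL, h𝕏, PowerSeries.coeff_X_pow]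
    · rw [hL (5, 0) (by simp), r0]; simp [hPL, h𝕏, PowerSeries.coeff_X_pow]
    · rw [hL (6, 1) (by simp), r1]; simp [hPL, h𝕏, PowerSeries.coeff_X_pow]
    · rw [hL (7, 0) (by simp), r0]; simp [hPL, h𝕏, PowerSeries.coeff_X_pow]
  -- (2) the Kubota–Leopoldt sides
  have hG := red_pfree_klTwo cg G₀ hG₀ hιG
  have hG8 : 𝕏 ^ 8 ∣ MuLambda.red (MuLambda.pfree G₀) - PG := by
    refine X_pow_eight_dvd_sub_of_coeff fun k hk ↦ ?_
    interval_cases k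
    · rw [hG (0, 1) (by simp), r1]; simp [hPG, h𝕏]
    · rw [hG (1, 0) (by simp), r0]; simp [hPG, h𝕏, PowerSeries.coeff_X_pow]
    · rw [hG (2, 1) (by simp), r1]; simp [hPG, h𝕏, PowerSeries.coeff_X_pow]
    · rw [hG (3, 0) (by simp), r0]; simp [hPG, h𝕏, PowerSeries.coeff_X_pow]
    · rw [hG (4, 0) (by simp), r0]; simp [hPG, h𝕏, PowerSeries.coeff_X_pow]
    · rw [hG (5, 1) (by simp), r1]; simp [hPG, h𝕏, PowerSeries.coeff_X_pow]
    · rw [hG (6, 0) (by simp), r0]; simp [hPG, h𝕏, PowerSeries.coeff_X_pow]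
    · rw [hG (7, 1) (by simp), r1]; simp [hPG, h𝕏, PowerSeries.coeff_X_pow]
  have hI := red_pfree_klTwoInv ci GI₀ hGI₀ hιGI
  have hI8 : 𝕏 ^ 8 ∣ MuLambda.red (MuLambda.pfree GI₀) - PI := by
    refine X_pow_eight_dvd_sub_of_coeff fun k hk ↦ ?_
    interval_cases k
    · rw [hI (0, 1) (by simp), r1]; simp [hPI, h𝕏]
    · rw [hI (1, 0) (by simp), r0]; simp [hPI, h𝕏, PowerSeries.coeff_X_pow]
    · rw [hI (2, 1) (by simp), r1]; simp [hPI, h𝕏, PowerSeries.coeff_X_pow]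
    · rw [hI (3, 0) (by simp), r0]; simp [hPI, h𝕏, PowerSeries.coeff_X_pow]
    · rw [hI (4, 1) (by simp), r1]; simp [hPI, h𝕏, PowerSeries.coeff_X_pow]
    · rw [hI (5, 1) (by simp), r1]; simp [hPI, h𝕏, PowerSeries.coeff_X_pow]
    · rw [hI (6, 0) (by simp), r0]; simp [hPI, h𝕏, PowerSeries.coeff_X_pow]
    · rw [hI (7, 0) (by simp), r0]; simp [hPI, h𝕏, PowerSeries.coeff_X_pow]
  -- (3) the Euler factors and the binomial
  have hE3 : 𝕏 ^ 8 ∣ MuLambda.red (frobeniusSeries 2 3 - 1) - P3 := by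
    refine X_pow_eight_dvd_sub_of_coeff fun k hk ↦ ?_
    rw [coeff_red_frobeniusSeries_three_sub_one k hk]
    congr 1
    simp [hP3, h𝕏, MuLambda.red, map_sub, map_pow, map_add, PowerSeries.map_X]
  have hE5 : MuLambda.red (frobeniusSeries 2 5 - 1) = 𝕏 := by
    rw [frobeniusSeries_two_five, add_sub_cancel_left, h𝕏, MuLambda.red, PowerSeries.map_X]
  have hB : MuLambda.red (PowerSeries.binomialSeries ℤ_[2] ((5 : ℕ) : ℤ_[2])) = (1 + 𝕏) ^ 5 := by
    rw [PowerSeries.binomialSeries_nat, MuLambda.red, map_pow, map_add, map_one, PowerSeries.map_X]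
  -- (4) pass to the quotient by `(T⁸)` and use the integer certificate
  have h2 : (2 : PowerSeries (IsLocalRing.ResidueField ℤ_[2])) = 0 := CharP.cast_eq_zero _ 2 |> fun h ↦ by exact_mod_cast h
  set I : Ideal (PowerSeries (IsLocalRing.ResidueField ℤ_[2])) := Ideal.span {𝕏 ^ 8} with hIdef
  have toQ : ∀ {a b : PowerSeries (IsLocalRing.ResidueField ℤ_[2])}, 𝕏 ^ 8 ∣ a - b →
      Ideal.Quotient.mk I a = Ideal.Quotient.mk I b :=
    fun h ↦ (Ideal.Quotient.eq).mpr (Ideal.mem_span_singleton.mpr h)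
  have key : Ideal.Quotient.mk I (𝕏 ^ 2 * PL) = Ideal.Quotient.mk I ((1 + 𝕏) ^ 5 * PG * PI * (P3 * 𝕏)) := by
    refine toQ ⟨-(248 * 1 + 306 * 𝕏 + 356 * 𝕏 ^ 2 + 377 * 𝕏 ^ 3 + 361 * 𝕏 ^ 4 + 324 * 𝕏 ^ 5 + 291 * 𝕏 ^ 6 +
      264 * 𝕏 ^ 7 + 225 * 𝕏 ^ 8 + 164 * 𝕏 ^ 9 + 93 * 𝕏 ^ 10 + 37 * 𝕏 ^ 11 + 9 * 𝕏 ^ 12 + 𝕏 ^ 13), ?_⟩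
    rw [hPL, hPG, hPI, hP3]
    linear_combination (-(𝕏 ^ 2 + 9 * 𝕏 ^ 3 + 26 * 𝕏 ^ 4 + 50 * 𝕏 ^ 5 + 76 * 𝕏 ^ 6 + 100 * 𝕏 ^ 7)) * h2
  -- freeze the five reductions, then compute in `𝔽₂⟦T⟧ ⧸ (T⁸)`
  set FL := MuLambda.red (MuLambda.pfree L₀) with hFL
  set FG := MuLambda.red (MuLambda.pfree G₀) with hFG
  set FI := MuLambda.red (MuLambda.pfree GI₀) with hFI
  set E3 := MuLambda.red (frobeniusSeries 2 3 - 1) with hE3def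
  set E5 := MuLambda.red (frobeniusSeries 2 5 - 1) with hE5def
  set B5 := MuLambda.red (PowerSeries.binomialSeries ℤ_[2] ((5 : ℕ) : ℤ_[2])) with hB5
  rw [← Ideal.mem_span_singleton, ← hIdef, ← Ideal.Quotient.eq_zero_iff_mem]
  simp only [map_sub, map_mul]
  rw [toQ hL8, toQ hG8, toQ hI8, toQ hE3, hE5, hB, sub_eq_zero]
  simpa only [map_mul] using key

end Summit.BirchSwinnertonDyer.Rank2.LevelFifteen

end
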